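import Mathlib
import Summits.RiemannHypothesis.RiemannHypothesis.Theorems.WeilFarFloorSecondOrderLawRH
import Summits.RiemannHypothesis.RiemannHypothesis.Theorems.WeilFarFloorResidualEnergy
import HarnessLib

/-!
# C-XIII″ with the rate `C(a+2)⁵e^{−a}` and as a limit, via the second-order law (under RH)

Helper file (`--supports stmt-RiemannHypothesis-0098`, lead-track anchor: Weil-positivity window ladder, format-C far bound),
pure proofs.  Seat rh-explicit-weil-1 gen15 (memo `run/shared/lean/pub/rh-explicit/rh-explicit-weil-1/FORMAT-K3.md` §16).

The second-order law (`WeilFarFloorSecondOrderLawRH.farCoercivityFloor_le_coshQuotient_add_secondOrder_of_RH`: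
`λ_max(a) ≤ R_c(a) + (1+ε)J(a)/R_c(a) + εe^{−a}` eventually) together with the von Koch bound of the residual energy
(`WeilFarFloorResidualEnergy.residualEnergy_le_of_RH`: `J(a) ≤ K a⁵`) and `R_c(a) ≥ e^a − C_q(a³+1)`
(`coshQuotient_ge_of_RH`) gives C-XIII″ («the cosh test is asymptotically THE extremal») with an explicit rate:

* `farCoercivityFloor_sub_coshQuotient_le_of_RH`: `RH → ∃ C a₀, ∀ a ≥ a₀, λ_max(a) ≤ R_c(a) + C·(a+2)⁵·e^{−a}`;
* `abs_farCoercivityFloor_sub_coshQuotient_le_of_RH` (two-sided, the cosh test being a competitor);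
* `farCoercivityFloor_le_coshQuotient_eventually_of_RH` (`∀ ε > 0`, eventually `λ_max ≤ R_c + ε`);
* ★ `tendsto_farCoercivityFloor_sub_coshQuotient_of_RH`: **`RH → λ_max(a) − R_c(a) → 0`**.

These are the statements of the staged `WeilFarFloorCoshOptimalRateRH` §2 (gen13/14, blocked behind the unbuilt
`WeilFarFloorZeroEnergyRH`/`WeilFarFloorCoshProfileEnergy`), now reached through files whose imports are all built; the staged
`WeilFarFloorResidualZeroSumRH` (the residual IS minus the zero sum; RH ⟹ C-XIII) imports this module instead.
Standard axioms only; RH enters as Mathlib's `RiemannHypothesis`.  Nothing here bears on the truth of RH.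
-/

set_option linter.dupNamespace false
set_option autoImplicit false

noncomputable section

open MeasureTheory Set Filter
open scoped Real Topology ArithmeticFunction.vonMangoldt

namespace Summit.RiemannHypothesis.RiemannHypothesis.Theorems.WeilFormatC

namespace FloorCoshSplit

open Literature.NumberTheory.LFunctions FloorCosh FloorEnvelope

/-- ★ **C-XIII″ WITH AN EXPLICIT RATE UNDER RH**:
`RiemannHypothesis → ∃ C a₀, ∀ a ≥ a₀, λ_max(a) ≤ Q_a(χ_a)/(a + sinh a) + C·(a+2)⁵·e^{−a}`
(second-order law with `ε = 1`, `J(a) ≤ K a⁵`, `R_c(a) ≥ e^a/2` eventually; `C = 4K + 1`). -/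
theorem farCoercivityFloor_sub_coshQuotient_le_of_RH (hRH : RiemannHypothesis) :
    ∃ C a₀ : ℝ, ∀ a : ℝ, a₀ ≤ a →
      farCoercivityFloor a
        ≤ primeShiftForm a ((Icc (-a) a).indicator (fun y ↦ Real.cosh (y / 2))) / (a + Real.sinh a)
          + C * (a + 2) ^ 5 * Real.exp (-a) := by
  obtain ⟨K, hK, hJ⟩ := residualEnergy_le_of_RH hRH
  obtain ⟨Cq, hCq0, hRlow⟩ := coshQuotient_ge_of_RH hRH
  obtain ⟨a₀, ha₀⟩ := farCoercivityFloor_le_coshQuotient_add_secondOrder_of_RH hRH one_pos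
  -- the threshold: `C_q(a³ + 1) ≤ e^a/2`
  have hΦ : Tendsto (fun a : ℝ ↦ (a ^ 3 + 1) * Real.exp (-a)) atTop (𝓝 0) := by
    have h := (Real.tendsto_pow_mul_exp_neg_atTop_nhds_zero 3).add Real.tendsto_exp_neg_atTop_nhds_zero
    rw [add_zero] at h
    exact h.congr' (Eventually.of_forall fun a ↦ by ring)
  have hc0 : (0 : ℝ) < 1 / (2 * (Cq + 1)) := by positivity
  obtain ⟨a₁, ha₁⟩ := Filter.eventually_atTop.1 (hΦ.eventually (Iio_mem_nhds hc0))
  refine ⟨4 * K + 1, max (max a₀ a₁) 1, fun a ha ↦ ?_⟩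
  have ha0' : a₀ ≤ a := le_trans (le_trans (le_max_left _ _) (le_max_left _ _)) ha
  have ha1' : a₁ ≤ a := le_trans (le_trans (le_max_right _ _) (le_max_left _ _)) ha
  have ha1 : 1 ≤ a := le_trans (le_max_right _ _) ha
  have ha0 : 0 < a := by linarith only [ha1]
  set X := Real.exp a with hX
  set t := Real.exp (-a) with ht
  have hX0 : 0 < X := Real.exp_pos _
  have ht0 : 0 < t := Real.exp_pos _
  have hXt : X * t = 1 := by rw [hX, ht, ← Real.exp_add]; simp
  set P := a + Real.sinh a with hP
  have hP0 : 0 < P := by have := Real.sinh_pos_iff.2 ha0; rw [hP]; linarith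
  set C : ℝ → ℝ := (Icc (-a) a).indicator (fun y ↦ Real.cosh (y / 2)) with hCdef
  set R := primeShiftForm a C / P with hR
  set I := ∫ x in Ioo (-a) a, ((∑ n ∈ weilPrimeIndex a, (Λ n : ℝ) / Real.sqrt n *
      (C (x - Real.log n) + C (x + Real.log n))) - R * C x) ^ 2 with hI
  have hI0 : 0 ≤ I := setIntegral_nonneg measurableSet_Ioo fun x _ ↦ sq_nonneg _
  -- `R ≥ X/2`
  have hΦa : (a ^ 3 + 1) * t < 1 / (2 * (Cq + 1)) := ha₁ a ha1'
  have hRlo : X - Cq * (a ^ 3 + 1) ≤ R := by rw [hR, hP, hCdef, hX]; exact hRlow a ha1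
  have hCqt : Cq * (a ^ 3 + 1) ≤ X / 2 := by
    have e : Cq * (a ^ 3 + 1) = Cq * ((a ^ 3 + 1) * t) * X := by
      have : Cq * ((a ^ 3 + 1) * t) * X = Cq * (a ^ 3 + 1) * (X * t) := by ring
      rw [this, hXt, mul_one]
    rw [e]
    have h2 : Cq * ((a ^ 3 + 1) * t) ≤ Cq * (1 / (2 * (Cq + 1))) := mul_le_mul_of_nonneg_left hΦa.le hCq0
    have h3 : Cq * (1 / (2 * (Cq + 1))) ≤ 1 / 2 := by
      rw [mul_one_div, div_le_iff₀ (by positivity)]; linarith only [hCq0]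
    nlinarith only [h2, h3, hX0]
  have hRX : X / 2 ≤ R := by linarith only [hRlo, hCqt]
  have hR0 : 0 < R := by linarith only [hRX, hX0]
  -- `J = I/P ≤ K a⁵`
  have hIle : I ≤ K * a ^ 5 * P := by rw [hI, hR, hP, hCdef]; exact hJ a ha1
  have hJle : I / P ≤ K * a ^ 5 := by rw [div_le_iff₀ hP0]; exact hIle
  -- the second-order law with `ε = 1`
  have hlaw := ha₀ a ha0'
  rw [← hCdef, ← hP, ← hR, ← hI] at hlaw
  -- `2·(I/P)/R ≤ 2Ka⁵·(2/X) = 4Ka⁵·t ≤ 4K(a+2)⁵t`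
  have h2 : (1 + 1) * (I / P) / R ≤ 4 * K * (a + 2) ^ 5 * t := by
    have h3 : (1 + 1) * (I / P) / R ≤ (1 + 1) * (K * a ^ 5) / (X / 2) :=
      div_le_div₀ (by positivity) (by linarith only [hJle]) (by positivity) hRX
    have e : (1 + 1) * (K * a ^ 5) / (X / 2) = 4 * K * a ^ 5 * t := by
      have : t = 1 / X := by field_simp; linarith only [hXt]
      rw [this]; field_simp; ring
    have h4 : a ^ 5 ≤ (a + 2) ^ 5 := pow_le_pow_left₀ ha0.le (by linarith only) 5
    have h5 : 4 * K * a ^ 5 * t ≤ 4 * K * (a + 2) ^ 5 * t := by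
      have := mul_le_mul_of_nonneg_left h4 (by positivity : (0:ℝ) ≤ 4 * K * t)
      nlinarith only [this]
    linarith only [h3, e.le, h5]
  have h6 : 1 * t ≤ 1 * (a + 2) ^ 5 * t := by
    have : (1 : ℝ) ≤ (a + 2) ^ 5 := one_le_pow₀ (by linarith only [ha0])
    nlinarith only [this, ht0]
  have e2 : (4 * K + 1) * (a + 2) ^ 5 * t = 4 * K * (a + 2) ^ 5 * t + 1 * (a + 2) ^ 5 * t := by ring
  rw [e2]
  linarith only [hlaw, h2, h6]

/-- **Two-sided form**: under RH, `|λ_max(a) − Q_a(χ_a)/(a + sinh a)| ≤ C·(a+2)⁵·e^{−a}` for all large `a`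
(the cosh test is a competitor, `coshQuotient_le_farCoercivityFloor`). -/
theorem abs_farCoercivityFloor_sub_coshQuotient_le_of_RH (hRH : RiemannHypothesis) :
    ∃ C a₀ : ℝ, ∀ a : ℝ, a₀ ≤ a →
      |farCoercivityFloor a
        - primeShiftForm a ((Icc (-a) a).indicator (fun y ↦ Real.cosh (y / 2))) / (a + Real.sinh a)|
          ≤ C * (a + 2) ^ 5 * Real.exp (-a) := by
  obtain ⟨C, a₀, h⟩ := farCoercivityFloor_sub_coshQuotient_le_of_RH hRH
  refine ⟨C, max a₀ 1, fun a ha ↦ ?_⟩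
  have h1 := h a (le_trans (le_max_left _ _) ha)
  have h2 := coshQuotient_le_farCoercivityFloor (a := a) (by linarith [le_max_right a₀ 1])
  rw [abs_le]; constructor <;> nlinarith [h1, h2, Real.exp_pos (-a), pow_nonneg (by linarith [le_max_right a₀ 1] : (0:ℝ) ≤ a + 2) 5]

/-- **C-XIII″ (qualitative form, from the rate)**: `RH → ∀ ε > 0, ∃ a₀, ∀ a ≥ a₀, λ_max(a) ≤ Q_a(χ_a)/(a + sinh a) + ε`. -/
theorem farCoercivityFloor_le_coshQuotient_eventually_of_RH (hRH : RiemannHypothesis) {ε : ℝ} (hε : 0 < ε) :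
    ∃ a₀ : ℝ, ∀ a : ℝ, a₀ ≤ a →
      farCoercivityFloor a
        ≤ primeShiftForm a ((Icc (-a) a).indicator (fun y ↦ Real.cosh (y / 2))) / (a + Real.sinh a) + ε := by
  obtain ⟨C, a₀, h⟩ := farCoercivityFloor_sub_coshQuotient_le_of_RH hRH
  have hT : Tendsto (fun a : ℝ ↦ C * (a + 2) ^ 5 * Real.exp (-a)) atTop (𝓝 0) := by
    have h1 := ((Real.tendsto_pow_mul_exp_neg_atTop_nhds_zero 5).comp
      (tendsto_atTop_add_const_right atTop (2 : ℝ) tendsto_id)).const_mul (C * Real.exp 2)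
    rw [mul_zero] at h1
    refine h1.congr' (Eventually.of_forall fun a ↦ ?_)
    simp only [Function.comp_apply, id]
    rw [show C * Real.exp 2 * ((a + 2) ^ 5 * Real.exp (-(a + 2))) = C * (a + 2) ^ 5 * (Real.exp 2 * Real.exp (-(a + 2))) by ring,
      ← Real.exp_add]
    ring_nf
  obtain ⟨a₁, ha₁⟩ := Filter.eventually_atTop.1 (hT.eventually (gt_mem_nhds hε))
  exact ⟨max a₀ a₁, fun a ha ↦ by
    have h1 := h a (le_trans (le_max_left _ _) ha)
    have h2 := ha₁ a (le_trans (le_max_right _ _) ha)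
    linarith⟩

/-- ★ **C-XIII″ as a limit: under RH, `λ_max(a) − Q_a(χ_a)/(a + sinh a) → 0` as `a → ∞`.** -/
theorem tendsto_farCoercivityFloor_sub_coshQuotient_of_RH (hRH : RiemannHypothesis) :
    Tendsto (fun a : ℝ ↦ farCoercivityFloor a
      - primeShiftForm a ((Icc (-a) a).indicator (fun y ↦ Real.cosh (y / 2))) / (a + Real.sinh a)) atTop (𝓝 0) := by
  rw [Metric.tendsto_atTop]
  intro ε hε
  obtain ⟨a₀, ha₀⟩ := farCoercivityFloor_le_coshQuotient_eventually_of_RH hRH (half_pos hε)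
  refine ⟨max a₀ 1, fun a ha ↦ ?_⟩
  have h1 := ha₀ a (le_trans (le_max_left _ _) ha)
  have h2 := coshQuotient_le_farCoercivityFloor (a := a) (by linarith [le_max_right a₀ 1])
  rw [Real.dist_eq, abs_lt]
  constructor <;> linarith

end FloorCoshSplit

end Summit.RiemannHypothesis.RiemannHypothesis.Theorems.WeilFormatC
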